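import Literature.LinearAlgebra.Matrix.SubfieldEntries

/-!
# Real approximation for unitary groups of hermitian forms, by the Cayley transform

Let `K ⊆ ℂ` be a subfield which is dense and stable under complex conjugation (e.g. the image of a CM field
under a complex embedding, `Literature.LinearAlgebra.Matrix.dense_fieldRange_of_isTotallyComplex` /
`conj_mem_fieldRange_of_isCMField`), and let `H ∈ Mₙ(K)` be hermitian with `det H ≠ 0`.  Write
`U(H) = {G ∈ Mₙ(ℂ) | Gᴴ H G = H}` and `U(H)(K) = U(H) ∩ Mₙ(K)` (`kUnitary K H`, a submonoid of `Mₙ(ℂ)`).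

* **`closure_kUnitary`** : every `G ∈ U(H)` lies in the closure of `U(H)(K)`; `dense_kUnitary_subtype` : the
  same as density in the subspace `U(H)`.

This is the archimedean case of weak approximation for the (connected, `K₀`-rational, `K₀ = K ∩ ℝ`) unitary
group — classically deduced from the rationality of the group variety (Cayley parametrisation) as in
Platonov–Rapinchuk, *Algebraic groups and number theory*, §7.1; here it is PROVED directly, in Mathlib
generality and with no algebraic-group theory, by the CAYLEY TRANSFORM:
(1) `K`-matrices `X` with `Xᴴ H = -H X` are dense among all such complex matrices (image of the dense set
`Mₙ(K)` under `M ↦ H⁻¹ (M - Mᴴ)`, `skewSet_subset_closure`); (2) `X ↦ (1+X)(1-X)⁻¹` is continuous where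
`det (1-X) ≠ 0`, preserves `K`-rationality, maps such `X` into `U(H)` (`cayley_unitary`) and hits every
`G ∈ U(H)` with `det (1+G) ≠ 0` (`mem_closure_kUnitary_of_det_ne_zero`); (3) a general `G ∈ U(H)` is
`(ζ • 1) * (ζ⁻¹ • G)` with a unit scalar `ζ = (1+it)(1-it)⁻¹` chosen off the finitely many `ζ` with
`det (1 + ζ⁻¹ G) = 0` (`finite_det_one_add_smul_eq_zero`, `circ`), and the closure of the monoid `U(H)(K)` is
closed under products.  All statements are proved from Mathlib; tags are [folklore].

The transfer to the topological group `GL n ℂ` and to conjugate forms `Tᴴ H T = J` is in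
`UnitaryRealApproximationGL.lean`.

## Provenance

Staged by the pub-hodgecm formalisation cell (DAG-node prover #01 lineage) under the LEAN-IN-TREE rule; it
supersedes the core section (lines 180–461) of the cell's standalone package file
`HodgeCM/PerL34/RealApproximation.lean` (namespace `HodgeCM.PerL34.RealApproximation` ↦
`Literature.GroupTheory.ArithmeticGroups.RealApproximation`, same short names), where it discharges the
printed input "the rational points of the unitary group are dense in the real points" of two lemmas.

## Not here

Weak approximation at finite places or for general reductive groups; strong approximation.
-/

set_option autoImplicit false

noncomputable section

open Matrix Topology Filter
open scoped ComplexConjugate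
open Literature.LinearAlgebra.Matrix

namespace Literature.GroupTheory.ArithmeticGroups

namespace RealApproximation

variable {n : Type*} [Fintype n] [DecidableEq n]

/-! ## The unitary monoid of `H` over `K`, and `H`-skew-adjoint matrices -/

section Core

variable (K : Subfield ℂ) (H : Matrix n n ℂ)

/-- `U(H)(K)`: the `K`-matrices `G` with `Gᴴ H G = H`, as a submonoid of `Mₙ(ℂ)`. [folklore] -/
def kUnitary : Submonoid (Matrix n n ℂ) where
  carrier := {G | IsKMat K G ∧ Gᴴ * H * G = H}
  one_mem' := ⟨IsKMat.one, by simp⟩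
  mul_mem' := by
    rintro A B ⟨hAK, hA⟩ ⟨hBK, hB⟩
    refine ⟨hAK.mul hBK, ?_⟩
    calc (A * B)ᴴ * H * (A * B) = Bᴴ * (Aᴴ * H * A) * B := by
          simp only [conjTranspose_mul, Matrix.mul_assoc]
      _ = H := by rw [hA, hB]

/-- Membership in `U(H)(K)`, definitionally. [folklore] -/
theorem mem_kUnitary_iff {G : Matrix n n ℂ} : G ∈ kUnitary K H ↔ IsKMat K G ∧ Gᴴ * H * G = H := Iff.rfl

/-- The `H`-skew-adjoint matrices (`Xᴴ H = -H X`), the Lie algebra of `U(H)`. [folklore] -/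
def skewSet : Set (Matrix n n ℂ) := {X | Xᴴ * H = -(H * X)}

variable {K H}

omit [DecidableEq n] in
/-- Membership in the `H`-skew-adjoint matrices, definitionally. [folklore] -/
theorem mem_skewSet_iff {X : Matrix n n ℂ} : X ∈ skewSet H ↔ Xᴴ * H = -(H * X) := Iff.rfl

/-- The parametrisation `M ↦ H⁻¹ (M - Mᴴ)` lands in the `H`-skew-adjoint matrices. [folklore] -/
theorem param_mem_skewSet (hH : Hᴴ = H) (hHd : IsUnit H.det) (M : Matrix n n ℂ) :
    H⁻¹ * (M - Mᴴ) ∈ skewSet H := by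
  rw [mem_skewSet_iff, conjTranspose_mul, conjTranspose_nonsing_inv, hH, conjTranspose_sub,
    conjTranspose_conjTranspose, Matrix.mul_assoc, nonsing_inv_mul _ hHd, Matrix.mul_one,
    ← Matrix.mul_assoc, mul_nonsing_inv _ hHd, Matrix.one_mul, neg_sub]

/-- ... and it is onto: `X = H⁻¹ (M - Mᴴ)` for `M = ½ H X`. [folklore] -/
theorem param_half (hH : Hᴴ = H) (hHd : IsUnit H.det) {X : Matrix n n ℂ} (hX : X ∈ skewSet H) :
    H⁻¹ * ((2 : ℂ)⁻¹ • (H * X) - ((2 : ℂ)⁻¹ • (H * X))ᴴ) = X := by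
  have h1 : ((2 : ℂ)⁻¹ • (H * X))ᴴ = -((2 : ℂ)⁻¹ • (H * X)) := by
    rw [conjTranspose_smul, conjTranspose_mul, hH, hX, smul_neg]
    congr 1
    simp
  rw [h1, sub_neg_eq_add, ← two_smul ℂ, smul_smul, mul_inv_cancel₀ (two_ne_zero : (2 : ℂ) ≠ 0), one_smul,
    ← Matrix.mul_assoc, nonsing_inv_mul _ hHd, Matrix.one_mul]

/-- **Step 1.** `K`-rational `H`-skew-adjoint matrices are dense in all `H`-skew-adjoint matrices.
[folklore] -/
theorem skewSet_subset_closure (hK : ∀ z ∈ K, conj z ∈ K) (hKd : Dense (K : Set ℂ)) (hHK : IsKMat K H)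
    (hH : Hᴴ = H) (hHd : IsUnit H.det) :
    skewSet H ⊆ closure {X | IsKMat K X ∧ X ∈ skewSet H} := by
  intro X hX
  let φ : Matrix n n ℂ → Matrix n n ℂ := fun M => H⁻¹ * (M - Mᴴ)
  have hφc : Continuous φ :=
    continuous_const.matrix_mul (continuous_id.sub continuous_id.matrix_conjTranspose)
  have hmem : (2 : ℂ)⁻¹ • (H * X) ∈ closure {A : Matrix n n ℂ | IsKMat K A} := dense_isKMat hKd n n _
  have himg := hφc.continuousWithinAt.mem_closure_image hmem
  rw [show φ ((2 : ℂ)⁻¹ • (H * X)) = X from param_half hH hHd hX] at himg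
  refine closure_mono ?_ himg
  rintro _ ⟨M, hM, rfl⟩
  exact ⟨(hHK.inv).mul (IsKMat.sub hM (hM.conjTranspose hK)), param_mem_skewSet hH hHd M⟩

/-! ## The Cayley transform -/

/-- The Cayley transform `C(X) = (1 + X)(1 - X)⁻¹`. [folklore] -/
def cayley (X : Matrix n n ℂ) : Matrix n n ℂ := (1 + X) * (1 - X)⁻¹

/-- The Cayley transform of a `K`-matrix is a `K`-matrix. [folklore] -/
theorem cayley_isKMat {X : Matrix n n ℂ} (hX : IsKMat K X) : IsKMat K (cayley X) :=
  (IsKMat.one.add hX).mul (IsKMat.one.sub hX).inv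

/-- Characterisation: if `Y (1 - X) = 1 + X` and `1 - X` is invertible then `C(X) = Y`.
[folklore] -/
theorem cayley_eq_of_mul_eq {X Y : Matrix n n ℂ} (hu : IsUnit (1 - X).det) (h : Y * (1 - X) = 1 + X) :
    cayley X = Y := by
  rw [cayley, ← h, mul_nonsing_inv_cancel_right _ _ hu]

/-- The Cayley transform is continuous at every `X` with `det (1 - X) ≠ 0`. [folklore] -/
theorem continuousAt_cayley {X : Matrix n n ℂ} (hu : (1 - X).det ≠ 0) : ContinuousAt cayley X := by
  have h1 : ContinuousAt (fun Y : Matrix n n ℂ => 1 - Y) X := (continuous_const.sub continuous_id).continuousAt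
  have h2 : ContinuousAt Inv.inv (1 - X) := by
    refine continuousAt_matrix_inv _ ?_
    rw [Ring.inverse_eq_inv']
    exact continuousAt_inv₀ hu
  exact ((continuous_const.add continuous_id).continuousAt).mul (h2.comp h1)

/-- **Step 2a.** The Cayley transform of an `H`-skew-adjoint `X` with `1 - X` invertible is in `U(H)`.
[folklore] -/
theorem cayley_unitary {X : Matrix n n ℂ} (hX : X ∈ skewSet H) (hu : IsUnit (1 - X).det) :
    (cayley X)ᴴ * H * cayley X = H := by
  have hXH : Xᴴ * H = -(H * X) := hX
  -- the two intertwining identities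
  have e1 : (1 + X)ᴴ * H = H * (1 - X) := by
    rw [conjTranspose_add, conjTranspose_one, add_mul, Matrix.one_mul, hXH, mul_sub, Matrix.mul_one,
      sub_eq_add_neg]
  have e2 : (1 - X)ᴴ * H = H * (1 + X) := by
    rw [conjTranspose_sub, conjTranspose_one, sub_mul, Matrix.one_mul, hXH, sub_neg_eq_add, mul_add,
      Matrix.mul_one]
  have comm : (1 - X) * (1 + X) = (1 + X) * (1 - X) := by
    simp only [mul_add, add_mul, mul_sub, sub_mul, Matrix.mul_one, Matrix.one_mul]
    abel
  have huH : IsUnit (1 - X)ᴴ.det := by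
    rw [det_conjTranspose]
    exact hu.star
  calc (cayley X)ᴴ * H * cayley X
      = (1 - X)ᴴ⁻¹ * ((1 + X)ᴴ * H) * (1 + X) * (1 - X)⁻¹ := by
        simp only [cayley, conjTranspose_mul, conjTranspose_nonsing_inv, Matrix.mul_assoc]
    _ = (1 - X)ᴴ⁻¹ * H * ((1 - X) * (1 + X)) * (1 - X)⁻¹ := by
        rw [e1]; simp only [Matrix.mul_assoc]
    _ = (1 - X)ᴴ⁻¹ * (H * (1 + X)) * ((1 - X) * (1 - X)⁻¹) := by
        rw [comm]; simp only [Matrix.mul_assoc]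
    _ = (1 - X)ᴴ⁻¹ * ((1 - X)ᴴ * H) := by
        rw [mul_nonsing_inv _ hu, Matrix.mul_one, e2]
    _ = H := by
        rw [← Matrix.mul_assoc, nonsing_inv_mul _ huH, Matrix.one_mul]

/-- **Step 2b.** Every `G ∈ U(H)` with `det (1 + G) ≠ 0` is a Cayley transform, hence in the closure of
`U(H)(K)`. [folklore] -/
theorem mem_closure_kUnitary_of_det_ne_zero (hK : ∀ z ∈ K, conj z ∈ K) (hKd : Dense (K : Set ℂ))
    (hHK : IsKMat K H) (hH : Hᴴ = H) (hHd : IsUnit H.det) {G : Matrix n n ℂ} (hG : Gᴴ * H * G = H)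
    (hG1 : (1 + G).det ≠ 0) : G ∈ closure (kUnitary K H : Set (Matrix n n ℂ)) := by
  have hu1 : IsUnit (1 + G).det := isUnit_iff_ne_zero.mpr hG1
  -- the inverse Cayley transform of `G`
  set X : Matrix n n ℂ := (G - 1) * (1 + G)⁻¹ with hXdef
  -- (1 - X)(1 + G) = 2
  have h1X : (1 - X) * (1 + G) = (2 : ℂ) • (1 : Matrix n n ℂ) := by
    rw [hXdef, sub_mul, Matrix.one_mul, Matrix.mul_assoc, nonsing_inv_mul _ hu1, Matrix.mul_one, two_smul]
    abel
  have hu : IsUnit (1 - X).det := by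
    have h := congrArg Matrix.det h1X
    rw [det_mul, det_smul, det_one, mul_one] at h
    rw [isUnit_iff_ne_zero]
    intro h0
    rw [h0, zero_mul] at h
    exact pow_ne_zero _ two_ne_zero h.symm
  -- G (1 - X) = 1 + X, checked after multiplying by the invertible (1 + G) on the right
  have hGX : G * (1 - X) = 1 + X := by
    have key : G * (1 - X) * (1 + G) = (1 + X) * (1 + G) := by
      rw [Matrix.mul_assoc, h1X, hXdef, add_mul, Matrix.one_mul, Matrix.mul_assoc, nonsing_inv_mul _ hu1,
        Matrix.mul_one, Matrix.mul_smul, Matrix.mul_one, two_smul]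
      abel
    calc G * (1 - X) = G * (1 - X) * (1 + G) * (1 + G)⁻¹ := by rw [mul_nonsing_inv_cancel_right _ _ hu1]
      _ = (1 + X) * (1 + G) * (1 + G)⁻¹ := by rw [key]
      _ = 1 + X := by rw [mul_nonsing_inv_cancel_right _ _ hu1]
  have hcay : cayley X = G := cayley_eq_of_mul_eq hu hGX
  -- X is H-skew-adjoint
  have hX : X ∈ skewSet H := by
    rw [mem_skewSet_iff, ← add_eq_zero_iff_eq_neg]
    have hu1H : IsUnit (1 + G)ᴴ.det := by rw [det_conjTranspose]; exact hu1.star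
    have eX : Xᴴ * H = (1 + G)ᴴ⁻¹ * ((Gᴴ - 1) * H * (1 + G)) * (1 + G)⁻¹ := by
      rw [hXdef, conjTranspose_mul, conjTranspose_nonsing_inv, conjTranspose_sub, conjTranspose_one]
      simp only [Matrix.mul_assoc]
      rw [mul_nonsing_inv _ hu1, Matrix.mul_one]
    have eY : H * X = (1 + G)ᴴ⁻¹ * ((Gᴴ + 1) * H * (G - 1)) * (1 + G)⁻¹ := by
      have hc : Gᴴ + 1 = (1 + G)ᴴ := by rw [conjTranspose_add, conjTranspose_one, add_comm]
      rw [hc, hXdef]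
      simp only [Matrix.mul_assoc]
      rw [← Matrix.mul_assoc (1 + G)ᴴ⁻¹, nonsing_inv_mul _ hu1H, Matrix.one_mul]
    have bracket : (Gᴴ - 1) * H * (1 + G) + (Gᴴ + 1) * H * (G - 1) = (2 : ℂ) • (Gᴴ * H * G - H) := by
      rw [two_smul]
      simp only [sub_mul, add_mul, mul_add, mul_sub, Matrix.one_mul, Matrix.mul_one]
      abel
    rw [eX, eY, ← Matrix.add_mul, ← Matrix.mul_add, bracket, hG, sub_self, smul_zero, Matrix.mul_zero,
      Matrix.zero_mul]
  -- density: X ∈ closure of the K-rational skew matrices with det (1 - ·) ≠ 0, push through `cayley`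
  have hXcl : X ∈ closure {Y | IsKMat K Y ∧ Y ∈ skewSet H} := skewSet_subset_closure hK hKd hHK hH hHd hX
  have hO : IsOpen {Y : Matrix n n ℂ | (1 - Y).det ≠ 0} :=
    isOpen_ne_fun ((continuous_const.sub continuous_id).matrix_det) continuous_const
  have hXO : X ∈ {Y : Matrix n n ℂ | (1 - Y).det ≠ 0} := isUnit_iff_ne_zero.mp hu
  have hXcl' : X ∈ closure ({Y : Matrix n n ℂ | (1 - Y).det ≠ 0} ∩ {Y | IsKMat K Y ∧ Y ∈ skewSet H}) :=
    hO.inter_closure ⟨hXO, hXcl⟩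
  have himg := (continuousAt_cayley (isUnit_iff_ne_zero.mp hu)).continuousWithinAt.mem_closure_image hXcl'
  rw [hcay] at himg
  refine closure_mono ?_ himg
  rintro _ ⟨Y, ⟨hYu, hYK, hYs⟩, rfl⟩
  exact ⟨cayley_isKMat hYK, cayley_unitary hYs (isUnit_iff_ne_zero.mpr hYu)⟩

/-! ## Unit scalars: removing the condition `det (1 + G) ≠ 0` -/

/-- Unit scalar multiples of elements of `U(H)` are in `U(H)`. [folklore] -/
theorem smul_unitary {G : Matrix n n ℂ} (hG : Gᴴ * H * G = H) {ζ : ℂ} (hζ : conj ζ * ζ = 1) :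
    (ζ • G)ᴴ * H * (ζ • G) = H := by
  rw [conjTranspose_smul, Complex.star_def, smul_mul_assoc, smul_mul_assoc, mul_smul_comm, smul_smul, hζ,
    one_smul, hG]

/-- For any `G`, only finitely many scalars `w` have `det (1 + w G) = 0`. [folklore] -/
theorem finite_det_one_add_smul_eq_zero (G : Matrix n n ℂ) : {w : ℂ | (1 + w • G).det = 0}.Finite := by
  classical
  -- the polynomial `P(w) = det (1 + w G)`
  let M : Matrix n n (Polynomial ℂ) :=
    Matrix.of fun i j => Polynomial.C ((1 : Matrix n n ℂ) i j) + Polynomial.X * Polynomial.C (G i j)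
  have hev : ∀ w : ℂ, (Polynomial.evalRingHom w).mapMatrix M = 1 + w • G := by
    intro w
    ext i j
    simp only [RingHom.mapMatrix_apply, Matrix.map_apply, M, Matrix.of_apply, Polynomial.coe_evalRingHom,
      Polynomial.eval_add, Polynomial.eval_C, Polynomial.eval_mul, Polynomial.eval_X, Matrix.add_apply,
      Matrix.smul_apply, smul_eq_mul]
  have hP : ∀ w : ℂ, (M.det).eval w = (1 + w • G).det := by
    intro w
    rw [← Polynomial.coe_evalRingHom, RingHom.map_det, hev]
  have hP0 : M.det ≠ 0 := by
    intro h0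
    have := hP 0
    rw [h0, Polynomial.eval_zero, zero_smul, add_zero, det_one] at this
    exact zero_ne_one this
  have hfin := Polynomial.finite_setOf_isRoot hP0
  refine hfin.subset ?_
  intro w hw
  simp only [Set.mem_setOf_eq] at hw ⊢
  rw [Polynomial.IsRoot.def, hP, hw]

/-- The rational parametrisation `t ↦ (1 + it)/(1 - it)` of the unit circle minus `{-1}`.
[folklore] -/
def circ (t : ℝ) : ℂ := (1 + t * Complex.I) / (1 - t * Complex.I)

/-- `1 - it ≠ 0` for real `t`. [folklore] -/
theorem one_sub_ne_zero (t : ℝ) : (1 : ℂ) - t * Complex.I ≠ 0 := by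
  intro h
  have := congrArg Complex.re h
  simp at this

/-- `1 + it ≠ 0` for real `t`. [folklore] -/
theorem one_add_ne_zero (t : ℝ) : (1 : ℂ) + t * Complex.I ≠ 0 := by
  intro h
  have := congrArg Complex.re h
  simp at this

/-- `conj ((1+it)/(1-it)) = (1-it)/(1+it)`. [folklore] -/
theorem conj_circ (t : ℝ) : conj (circ t) = (1 - t * Complex.I) / (1 + t * Complex.I) := by
  simp only [circ, map_div₀, map_add, map_sub, map_one, map_mul, Complex.conj_ofReal, Complex.conj_I]
  ring

/-- `circ t` is a unit scalar: `conj (circ t) * circ t = 1`. [folklore] -/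
theorem conj_circ_mul_circ (t : ℝ) : conj (circ t) * circ t = 1 := by
  rw [conj_circ, circ, div_mul_div_comm, mul_comm (1 + (t : ℂ) * Complex.I)]
  exact div_self (mul_ne_zero (one_sub_ne_zero t) (one_add_ne_zero t))

/-- `circ t * conj (circ t) = 1`. [folklore] -/
theorem circ_mul_conj_circ (t : ℝ) : circ t * conj (circ t) = 1 := by
  rw [mul_comm, conj_circ_mul_circ]

/-- `1 + circ t = 2/(1 - it)`. [folklore] -/
theorem one_add_circ (t : ℝ) : 1 + circ t = 2 / (1 - t * Complex.I) := by
  rw [circ, one_add_div (one_sub_ne_zero t)]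
  ring

/-- `circ t` is never `-1` (the point at `t = ∞`). [folklore] -/
theorem one_add_circ_ne_zero (t : ℝ) : 1 + circ t ≠ 0 := by
  rw [one_add_circ]
  exact div_ne_zero two_ne_zero (one_sub_ne_zero t)

/-- `t ↦ (1+it)/(1-it)` is injective on `ℝ`. [folklore] -/
theorem circ_injective : Function.Injective circ := by
  intro s t h
  rw [circ, circ, div_eq_div_iff (one_sub_ne_zero s) (one_sub_ne_zero t)] at h
  have := congrArg Complex.im h
  simp at this
  linarith

/-- **Step 3 / main theorem (matrix form).**  For a dense, conjugation-stable subfield `K ⊆ ℂ` and a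
hermitian `K`-matrix `H` with `det H ≠ 0`, every `G ∈ U(H)` is a limit of elements of `U(H)(K)`.
[folklore] -/
theorem closure_kUnitary (hK : ∀ z ∈ K, conj z ∈ K) (hKd : Dense (K : Set ℂ)) (hHK : IsKMat K H)
    (hH : Hᴴ = H) (hHd : H.det ≠ 0) {G : Matrix n n ℂ} (hG : Gᴴ * H * G = H) :
    G ∈ closure (kUnitary K H : Set (Matrix n n ℂ)) := by
  have hHu : IsUnit H.det := isUnit_iff_ne_zero.mpr hHd
  -- choose a good unit scalar
  have hbad : {t : ℝ | conj (circ t) ∈ {w : ℂ | (1 + w • G).det = 0}}.Finite := by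
    refine Set.Finite.preimage (Set.injOn_of_injective ?_) (finite_det_one_add_smul_eq_zero G)
    exact (RingHom.injective _).comp circ_injective
  obtain ⟨t, -, ht⟩ := Set.infinite_univ.exists_notMem_finite hbad
  simp only [Set.mem_setOf_eq] at ht
  set ζ : ℂ := circ t with hζ
  -- the two factors
  have hA : (ζ • (1 : Matrix n n ℂ)) ∈ closure (kUnitary K H : Set (Matrix n n ℂ)) := by
    refine mem_closure_kUnitary_of_det_ne_zero hK hKd hHK hH hHu (smul_unitary (by simp) ?_) ?_
    · rw [hζ, conj_circ_mul_circ]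
    · rw [show (1 : Matrix n n ℂ) + ζ • (1 : Matrix n n ℂ) = (1 + ζ) • (1 : Matrix n n ℂ) by
        rw [add_smul, one_smul], det_smul, det_one, mul_one]
      exact pow_ne_zero _ (one_add_circ_ne_zero t)
  have hB : (conj ζ • G) ∈ closure (kUnitary K H : Set (Matrix n n ℂ)) := by
    refine mem_closure_kUnitary_of_det_ne_zero hK hKd hHK hH hHu (smul_unitary hG ?_) ht
    rw [Complex.conj_conj, hζ, circ_mul_conj_circ]
  have hAB : ζ • (1 : Matrix n n ℂ) * (conj ζ • G) = G := by
    rw [smul_mul_assoc, Matrix.one_mul, smul_smul, hζ, circ_mul_conj_circ, one_smul]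
  rw [← hAB]
  exact (kUnitary K H).topologicalClosure.mul_mem hA hB

/-- `U(H)(K)` is dense in `U(H)` (subspace topology of `Mₙ(ℂ)`). [folklore] -/
theorem dense_kUnitary_subtype (hK : ∀ z ∈ K, conj z ∈ K) (hKd : Dense (K : Set ℂ)) (hHK : IsKMat K H)
    (hH : Hᴴ = H) (hHd : H.det ≠ 0) :
    Dense {G : ({G : Matrix n n ℂ | Gᴴ * H * G = H} : Set (Matrix n n ℂ)) | IsKMat K (G : Matrix n n ℂ)} := by
  rw [IsInducing.subtypeVal.dense_iff]
  rintro ⟨G, hG⟩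
  refine closure_mono ?_ (closure_kUnitary hK hKd hHK hH hHd hG)
  rintro Y ⟨hYK, hY⟩
  exact ⟨⟨Y, hY⟩, hYK, rfl⟩

end Core

end RealApproximation

end Literature.GroupTheory.ArithmeticGroups
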